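import Mathlib
import HarnessLib
import Literature.MathematicalPhysics.StatisticalMechanics.MuGSC
import Literature.MathematicalPhysics.StatisticalMechanics.LennardJonesClusters
import Summits.AtomisticToContinuum.Crystallization.Theorems.OverbindingBudgetCubeBookkeeping
import Summits.AtomisticToContinuum.Crystallization.Theorems.OverbindingBudgetCubeTails

/-!
# OverbindingBudget — PATCH CONTINUITY of the binding field (engine of the crux `BindingSignLaw`, stmt-29085)

For a uniformly discrete `Y ⊆ ℝ³` the binding field `φ_Y(p) = ∑'_(w ∈ Y) V_LJ(|p − w|)` depends continuously on the
local patch: for every `θ > 0` there are `R` and `ε > 0` such that whenever the `R`-patch of `Y` at `p ∈ Y` is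
two-way `ε`-matched to the `R`-patch at `q' ∈ Y` (the matching shape of the route's recurrence hypothesis), then
`|φ_Y(q') − φ_Y(p)| ≤ θ`.  Ingredients: the dyadic tail bound and the box packing of
`OverbindingBudgetCubeTails`, the finite/tail split `stub_siteSumSplit` of `OverbindingBudgetCubeBookkeeping`, and
a Lipschitz bound for `V_LJ` away from the origin.
-/

namespace Summit.AtomisticToContinuum.Crystallization.Theorems.OverbindingBudgetPatchContinuity

open Literature.MathematicalPhysics.StatisticalMechanics
open Summit.AtomisticToContinuum.Crystallization.Theorems.OverbindingBudgetCubeTails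
open Summit.AtomisticToContinuum.Crystallization.Theorems.OverbindingBudgetCubeBookkeeping (stub_siteSumSplit)

/-- Lipschitz bound for inverse powers on `[m, ∞)`: `|s⁻ⁿ − t⁻ⁿ| ≤ n m⁻ⁿ⁻¹ |s − t|`. [folklore] -/
theorem abs_inv_pow_sub_inv_pow_le {m s t : ℝ} (hm : 0 < m) (hs : m ≤ s) (ht : m ≤ t) :
    ∀ n : ℕ, |s⁻¹ ^ n - t⁻¹ ^ n| ≤ (n : ℝ) * m⁻¹ ^ (n + 1) * |s - t|
  | 0 => by simp
  | n + 1 => by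
    have ih := abs_inv_pow_sub_inv_pow_le hm hs ht n
    have hs0 : 0 < s := hm.trans_le hs
    have ht0 : 0 < t := hm.trans_le ht
    have h1 : s⁻¹ ≤ m⁻¹ := inv_anti₀ hm hs
    have h2 : t⁻¹ ≤ m⁻¹ := inv_anti₀ hm ht
    have hbase : |s⁻¹ - t⁻¹| ≤ m⁻¹ ^ 2 * |s - t| := by
      rw [inv_sub_inv hs0.ne' ht0.ne', abs_div, abs_of_pos (mul_pos hs0 ht0), abs_sub_comm,
        div_le_iff₀ (mul_pos hs0 ht0)]
      have hmm : 1 ≤ m⁻¹ ^ 2 * (s * t) := by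
        have e : m⁻¹ ^ 2 * (m * m) = 1 := by field_simp
        calc (1 : ℝ) = m⁻¹ ^ 2 * (m * m) := e.symm
          _ ≤ m⁻¹ ^ 2 * (s * t) :=
            mul_le_mul_of_nonneg_left (mul_le_mul hs ht hm.le hs0.le) (by positivity)
      nlinarith [abs_nonneg (s - t)]
    have e : s⁻¹ ^ (n + 1) - t⁻¹ ^ (n + 1) = s⁻¹ * (s⁻¹ ^ n - t⁻¹ ^ n) + t⁻¹ ^ n * (s⁻¹ - t⁻¹) := by
      ring
    rw [e]
    have hA : |s⁻¹ * (s⁻¹ ^ n - t⁻¹ ^ n)| ≤ m⁻¹ * ((n : ℝ) * m⁻¹ ^ (n + 1) * |s - t|) := by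
      rw [abs_mul, abs_of_nonneg (inv_nonneg.2 hs0.le)]
      exact mul_le_mul h1 ih (abs_nonneg _) (inv_nonneg.2 hm.le)
    have hB : |t⁻¹ ^ n * (s⁻¹ - t⁻¹)| ≤ m⁻¹ ^ n * (m⁻¹ ^ 2 * |s - t|) := by
      rw [abs_mul, abs_of_nonneg (pow_nonneg (inv_nonneg.2 ht0.le) n)]
      exact mul_le_mul (pow_le_pow_left₀ (inv_nonneg.2 ht0.le) h2 n) hbase (abs_nonneg _)
        (pow_nonneg (inv_nonneg.2 hm.le) n)
    calc |s⁻¹ * (s⁻¹ ^ n - t⁻¹ ^ n) + t⁻¹ ^ n * (s⁻¹ - t⁻¹)|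
        ≤ |s⁻¹ * (s⁻¹ ^ n - t⁻¹ ^ n)| + |t⁻¹ ^ n * (s⁻¹ - t⁻¹)| := abs_add_le _ _
      _ ≤ m⁻¹ * ((n : ℝ) * m⁻¹ ^ (n + 1) * |s - t|) + m⁻¹ ^ n * (m⁻¹ ^ 2 * |s - t|) := add_le_add hA hB
      _ = ((n + 1 : ℕ) : ℝ) * m⁻¹ ^ (n + 1 + 1) * |s - t| := by push_cast; ring

/-- Lipschitz bound for the Lennard-Jones potential on `[m, ∞)`: `|V(s) − V(t)| ≤ (m⁻¹³ + m⁻⁷)|s − t|`. [folklore] -/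
theorem abs_lennardJones_sub_le {m s t : ℝ} (hm : 0 < m) (hs : m ≤ s) (ht : m ≤ t) :
    |lennardJones s - lennardJones t| ≤ (m⁻¹ ^ 13 + m⁻¹ ^ 7) * |s - t| := by
  have h12 := abs_inv_pow_sub_inv_pow_le hm hs ht 12
  have h6 := abs_inv_pow_sub_inv_pow_le hm hs ht 6
  have e : lennardJones s - lennardJones t =
      1 / 12 * (s⁻¹ ^ 12 - t⁻¹ ^ 12) - 1 / 6 * (s⁻¹ ^ 6 - t⁻¹ ^ 6) := by
    unfold lennardJones; ring
  rw [e]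
  calc |1 / 12 * (s⁻¹ ^ 12 - t⁻¹ ^ 12) - 1 / 6 * (s⁻¹ ^ 6 - t⁻¹ ^ 6)|
      ≤ |1 / 12 * (s⁻¹ ^ 12 - t⁻¹ ^ 12)| + |1 / 6 * (s⁻¹ ^ 6 - t⁻¹ ^ 6)| := abs_sub _ _
    _ = 1 / 12 * |s⁻¹ ^ 12 - t⁻¹ ^ 12| + 1 / 6 * |s⁻¹ ^ 6 - t⁻¹ ^ 6| := by
        rw [abs_mul, abs_mul, abs_of_pos (by norm_num : (0:ℝ) < 1 / 12),
          abs_of_pos (by norm_num : (0:ℝ) < 1 / 6)]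
    _ ≤ 1 / 12 * ((12 : ℕ) * m⁻¹ ^ (12 + 1) * |s - t|) + 1 / 6 * ((6 : ℕ) * m⁻¹ ^ (6 + 1) * |s - t|) := by
        gcongr
    _ = (m⁻¹ ^ 13 + m⁻¹ ^ 7) * |s - t| := by push_cast; ring

set_option maxHeartbeats 1600000 in
/-- **Patch continuity of the binding field.** For a uniformly discrete `Y ⊆ ℝ³` and `θ > 0` there are `R` and
`ε > 0` such that for `p, q' ∈ Y` whose `R`-patches are two-way `ε`-matched (every point of `Y` within `R` of `p`
has a partner `y'` with `|(y' − q') − (y − p)| ≤ ε`, and conversely), `|φ_Y(q') − φ_Y(p)| ≤ θ`.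
[cite: Suto2006, §2 (μGSC field sums); folklore] -/
theorem field_patch_continuity {Y : Set (EuclideanSpace ℝ (Fin 3))} (hUD : UniformlyDiscrete Y) {θ : ℝ} (hθ : 0 < θ) :
    ∃ R ε : ℝ, 0 < ε ∧ ∀ p ∈ Y, ∀ q' ∈ Y,
      (∀ y ∈ Y, dist y p ≤ R → ∃ y' ∈ Y, dist (y' - q') (y - p) ≤ ε) →
      (∀ y' ∈ Y, dist y' q' ≤ R → ∃ y ∈ Y, dist (y' - q') (y - p) ≤ ε) →
      |(∑' w : ↥Y, lennardJones (dist q' (w : EuclideanSpace ℝ (Fin 3)))) -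
        (∑' w : ↥Y, lennardJones (dist p (w : EuclideanSpace ℝ (Fin 3))))| ≤ θ := by
  classical
  obtain ⟨δ, hδ, hsep⟩ := hUD
  have hUD : UniformlyDiscrete Y := ⟨δ, hδ, hsep⟩
  set G : ℝ := 432 * (δ⁻¹ ^ 6 + 1) * δ⁻¹ ^ 3 with hG
  have hG0 : 0 ≤ G := by positivity
  set Lip : ℝ := (δ / 2)⁻¹ ^ 13 + (δ / 2)⁻¹ ^ 7 with hLip
  have hLip0 : 0 < Lip := by positivity
  set R : ℝ := max (max 1 (2 * δ)) (20 * G / θ) with hR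
  have hR1 : 1 ≤ R := (le_max_left _ _).trans (le_max_left _ _)
  have hR2δ : 2 * δ ≤ R := (le_max_right _ _).trans (le_max_left _ _)
  have hRG : 20 * G / θ ≤ R := le_max_right _ _
  have hR0 : 0 < R := by linarith
  have hδR : δ ≤ R := by linarith
  set ε : ℝ := min (δ / 4) (θ / (54 * R ^ 3 * δ⁻¹ ^ 3 * Lip)) with hε
  have hε0 : 0 < ε := lt_min (by linarith) (by positivity)
  have hεδ4 : ε ≤ δ / 4 := min_le_left _ _
  have hεδ : ε ≤ δ / 2 := by linarith
  have hεθ : ε ≤ θ / (54 * R ^ 3 * δ⁻¹ ^ 3 * Lip) := min_le_right _ _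
  refine ⟨R, ε, hε0, ?_⟩
  intro p hp q' hq' hfwd hbwd
  -- the finite near patches
  have hfinp := hUD.finite_inter_closedBall p R
  have hfinq := hUD.finite_inter_closedBall q' R
  set Fp := hfinp.toFinset with hFp
  set Fq := hfinq.toFinset with hFq
  have hmemp : ∀ w, w ∈ Fp ↔ w ∈ Y ∧ dist w p ≤ R := fun w => by
    rw [hFp, Set.Finite.mem_toFinset]
    exact ⟨fun h => ⟨h.1, Metric.mem_closedBall.1 h.2⟩, fun h => ⟨h.1, Metric.mem_closedBall.2 h.2⟩⟩
  have hmemq : ∀ w, w ∈ Fq ↔ w ∈ Y ∧ dist w q' ≤ R := fun w => by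
    rw [hFq, Set.Finite.mem_toFinset]
    exact ⟨fun h => ⟨h.1, Metric.mem_closedBall.1 h.2⟩, fun h => ⟨h.1, Metric.mem_closedBall.2 h.2⟩⟩
  have hFpY : (↑Fp : Set (EuclideanSpace ℝ (Fin 3))) ⊆ Y := fun w hw => ((hmemp w).1 (Finset.mem_coe.1 hw)).1
  have hFqY : (↑Fq : Set (EuclideanSpace ℝ (Fin 3))) ⊆ Y := fun w hw => ((hmemq w).1 (Finset.mem_coe.1 hw)).1
  -- cardinalities
  have hcardp : (Fp.card : ℝ) ≤ 27 * R ^ 3 * δ⁻¹ ^ 3 := by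
    have h := card_le_of_separated_of_dist_le Fp p hδ hR0.le (fun w hw => ((hmemp w).1 hw).2)
      (fun z hz w hw hne => hsep z ((hmemp z).1 hz).1 w ((hmemp w).1 hw).1 hne)
    rw [finrank_euclideanSpace_fin] at h
    have h3 : 2 * R / δ + 1 ≤ 3 * R / δ := by
      rw [div_add_one hδ.ne', div_le_div_iff_of_pos_right hδ]; linarith
    calc (Fp.card : ℝ) ≤ (2 * R / δ + 1) ^ 3 := h
      _ ≤ (3 * R / δ) ^ 3 := pow_le_pow_left₀ (by positivity) h3 3
      _ = 27 * R ^ 3 * δ⁻¹ ^ 3 := by rw [div_eq_mul_inv]; ring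
  have hcardq : (Fq.card : ℝ) ≤ 27 * R ^ 3 * δ⁻¹ ^ 3 := by
    have h := card_le_of_separated_of_dist_le Fq q' hδ hR0.le (fun w hw => ((hmemq w).1 hw).2)
      (fun z hz w hw hne => hsep z ((hmemq z).1 hz).1 w ((hmemq w).1 hw).1 hne)
    rw [finrank_euclideanSpace_fin] at h
    have h3 : 2 * R / δ + 1 ≤ 3 * R / δ := by
      rw [div_add_one hδ.ne', div_le_div_iff_of_pos_right hδ]; linarith
    calc (Fq.card : ℝ) ≤ (2 * R / δ + 1) ^ 3 := h
      _ ≤ (3 * R / δ) ^ 3 := pow_le_pow_left₀ (by positivity) h3 3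
      _ = 27 * R ^ 3 * δ⁻¹ ^ 3 := by rw [div_eq_mul_inv]; ring
  -- finite/tail splits of the two fields
  have hsp := stub_siteSumSplit Y hUD Fp hFpY p
  have hsq := stub_siteSumSplit Y hUD Fq hFqY q'
  -- tails
  have htail : ∀ (c : EuclideanSpace ℝ (Fin 3)) (F : Finset (EuclideanSpace ℝ (Fin 3))), (∀ w, w ∈ F ↔ w ∈ Y ∧ dist w c ≤ R) →
      |∑' w : ↥(Y \ ↑F), lennardJones (dist c (w : EuclideanSpace ℝ (Fin 3)))| ≤ G * R⁻¹ ^ 3 := by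
    intro c F hmem
    rw [hG]
    refine abs_tsum_lennardJones_le_dyadic (T := Y \ ↑F) c hδ hδR ?_ ?_
    · rintro z ⟨hzY, hzF⟩
      have h2 : ¬ dist z c ≤ R := fun h => hzF (Finset.mem_coe.2 ((hmem z).2 ⟨hzY, h⟩))
      rw [dist_comm]; exact (lt_of_not_ge h2).le
    · exact fun z hz w hw hne => hsep z hz.1 w hw.1 hne
  have htp := htail p Fp hmemp
  have htq := htail q' Fq hmemq
  -- the matching map
  choose! m hmY hmd using hfwd
  have hm1 : ∀ y ∈ Fp, m y ∈ Y ∧ dist (m y - q') (y - p) ≤ ε := fun y hy =>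
    ⟨hmY y ((hmemp y).1 hy).1 ((hmemp y).1 hy).2, hmd y ((hmemp y).1 hy).1 ((hmemp y).1 hy).2⟩
  have hdd : ∀ y ∈ Fp, |dist q' (m y) - dist p y| ≤ ε := by
    intro y hy
    rw [dist_comm q', dist_comm p, dist_eq_norm, dist_eq_norm]
    have h := abs_norm_sub_norm_le (m y - q') (y - p)
    rw [← dist_eq_norm] at h
    exact h.trans (hm1 y hy).2
  have hminj : Set.InjOn m ↑Fp := by
    intro y hy y₂ hy₂ hmm
    have hy' := Finset.mem_coe.1 hy
    have hy₂' := Finset.mem_coe.1 hy₂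
    by_contra hne
    have h1 := (hm1 y hy').2
    have h2 := (hm1 y₂ hy₂').2
    rw [hmm] at h1
    have h3 : dist (y - p) (y₂ - p) ≤ ε + ε :=
      (dist_triangle_left _ _ (m y₂ - q')).trans (add_le_add h1 h2)
    rw [dist_sub_right] at h3
    have hδle := hsep y ((hmemp y).1 hy').1 y₂ ((hmemp y₂).1 hy₂').1 hne
    linarith
  set I := Fp.image m with hI
  have hImem : ∀ w ∈ I, ∃ y ∈ Fp, m y = w := fun w hw => by
    obtain ⟨y, hy, hyw⟩ := Finset.mem_image.1 hw; exact ⟨y, hy, hyw⟩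
  have hIY : ∀ w ∈ I, w ∈ Y := fun w hw => by
    obtain ⟨y, hy, rfl⟩ := hImem w hw; exact (hm1 y hy).1
  have hIdist : ∀ w ∈ I, dist w q' ≤ R + ε := fun w hw => by
    obtain ⟨y, hy, rfl⟩ := hImem w hw
    have h := hdd y hy
    have hyp := ((hmemp y).1 hy).2
    rw [dist_comm q', dist_comm p] at h
    have := (abs_le.1 h).2
    linarith
  -- the core of the q'-patch is matched
  have hcore : ∀ w' ∈ Fq, dist w' q' ≤ R - ε → w' ∈ I := by
    intro w' hw' hd
    have hw'Y := ((hmemq w').1 hw').1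
    obtain ⟨y, hyY, hyd⟩ := hbwd w' hw'Y (by linarith)
    have hyp : dist y p ≤ R := by
      have h := norm_sub_norm_le (y - p) (w' - q')
      have e1 : ‖(y - p) - (w' - q')‖ = dist (w' - q') (y - p) := by rw [dist_comm, dist_eq_norm]
      rw [e1] at h
      have hd' : dist w' q' ≤ R - ε := hd
      rw [dist_eq_norm] at hd' ⊢
      linarith
    have hyF : y ∈ Fp := (hmemp y).2 ⟨hyY, hyp⟩
    have hmy : m y = w' := by
      by_contra hne
      have hδle := hsep (m y) (hm1 y hyF).1 w' hw'Y hne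
      have h3 : dist (m y) w' ≤ ε + ε := by
        rw [← dist_sub_right (m y) w' q']
        exact (dist_triangle _ (y - p) _).trans (add_le_add (hm1 y hyF).2 (by rw [dist_comm]; exact hyd))
      linarith
    exact Finset.mem_image.2 ⟨y, hyF, hmy⟩
  -- the three finite error terms
  set K : ℝ := (δ⁻¹ ^ 6 + 1) * (R / 2)⁻¹ ^ 6 with hK
  have hK0 : 0 ≤ K := by positivity
  have hfar_bound : ∀ w : EuclideanSpace ℝ (Fin 3), R / 2 ≤ dist q' w → |lennardJones (dist q' w)| ≤ K := by
    intro w hw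
    have hRδ2 : δ ≤ R / 2 := by linarith
    have h := OverbindingBudgetCubeTails.abs_lennardJones_le_of_le hδ (hRδ2.trans hw)
    refine h.trans (mul_le_mul_of_nonneg_left ?_ (by positivity))
    exact pow_le_pow_left₀ (inv_nonneg.2 dist_nonneg) (inv_anti₀ (by linarith) hw) 6
  have hB1 : |∑ w ∈ Fq \ I, lennardJones (dist q' w)| ≤ 27 * R ^ 3 * δ⁻¹ ^ 3 * K := by
    have h1 : |∑ w ∈ Fq \ I, lennardJones (dist q' w)| ≤ ∑ w ∈ Fq \ I, K := by
      refine (Finset.abs_sum_le_sum_abs _ _).trans (Finset.sum_le_sum fun w hw => ?_)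
      obtain ⟨hwq, hwI⟩ := Finset.mem_sdiff.1 hw
      refine hfar_bound w ?_
      have hnot : ¬ dist w q' ≤ R - ε := fun h => hwI (hcore w hwq h)
      rw [dist_comm]; linarith [lt_of_not_ge hnot]
    refine h1.trans ?_
    rw [Finset.sum_const, nsmul_eq_mul]
    have hc : ((Fq \ I).card : ℝ) ≤ Fq.card := by exact_mod_cast Finset.card_le_card Finset.sdiff_subset
    nlinarith
  have hB2 : |∑ w ∈ I \ Fq, lennardJones (dist q' w)| ≤ 27 * R ^ 3 * δ⁻¹ ^ 3 * K := by
    have h1 : |∑ w ∈ I \ Fq, lennardJones (dist q' w)| ≤ ∑ w ∈ I \ Fq, K := by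
      refine (Finset.abs_sum_le_sum_abs _ _).trans (Finset.sum_le_sum fun w hw => ?_)
      obtain ⟨hwI, hwq⟩ := Finset.mem_sdiff.1 hw
      refine hfar_bound w ?_
      have hnot : ¬ dist w q' ≤ R := fun h => hwq ((hmemq w).2 ⟨hIY w hwI, h⟩)
      rw [dist_comm]; linarith [lt_of_not_ge hnot]
    refine h1.trans ?_
    rw [Finset.sum_const, nsmul_eq_mul]
    have hc : ((I \ Fq).card : ℝ) ≤ Fp.card := by
      exact_mod_cast (Finset.card_le_card Finset.sdiff_subset).trans Finset.card_image_le
    nlinarith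
  have hB3 : |∑ y ∈ Fp, (lennardJones (dist q' (m y)) - lennardJones (dist p y))| ≤
      27 * R ^ 3 * δ⁻¹ ^ 3 * (Lip * ε) := by
    have h1 : |∑ y ∈ Fp, (lennardJones (dist q' (m y)) - lennardJones (dist p y))| ≤
        ∑ y ∈ Fp, Lip * ε := by
      refine (Finset.abs_sum_le_sum_abs _ _).trans (Finset.sum_le_sum fun y hy => ?_)
      have hyY := ((hmemp y).1 hy).1
      by_cases hyp : y = p
      · -- the centre is matched to the centre
        subst hyp
        have hmp : m y = q' := by
          by_contra hne
          have hδle := hsep (m y) (hm1 y hy).1 q' hq' hne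
          have h := (hm1 y hy).2
          rw [sub_self, dist_eq_norm, sub_zero, ← dist_eq_norm] at h
          linarith
        rw [hmp, dist_self, dist_self, sub_self, abs_zero]
        positivity
      · have hδy : δ ≤ dist p y := by rw [dist_comm]; exact hsep y hyY p hp hyp
        have hm2 : δ / 2 ≤ dist q' (m y) := by
          have := (abs_le.1 (hdd y hy)).1; linarith
        have h := abs_lennardJones_sub_le (m := δ / 2) (s := dist q' (m y)) (t := dist p y)
          (by linarith) hm2 (by linarith)
        exact h.trans (mul_le_mul_of_nonneg_left (hdd y hy) hLip0.le)
    refine h1.trans ?_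
    rw [Finset.sum_const, nsmul_eq_mul]
    have : 0 ≤ Lip * ε := by positivity
    nlinarith
  -- algebra of the finite parts
  have e1 : ∑ w ∈ Fq, lennardJones (dist q' w) =
      ∑ w ∈ Fq ∩ I, lennardJones (dist q' w) + ∑ w ∈ Fq \ I, lennardJones (dist q' w) := by
    rw [← Finset.sum_filter_add_sum_filter_not Fq (fun w => w ∈ I), Finset.filter_mem_eq_inter,
      Finset.sdiff_eq_filter]
  have e2 : ∑ w ∈ I, lennardJones (dist q' w) =
      ∑ w ∈ Fq ∩ I, lennardJones (dist q' w) + ∑ w ∈ I \ Fq, lennardJones (dist q' w) := by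
    rw [← Finset.sum_filter_add_sum_filter_not I (fun w => w ∈ Fq), Finset.filter_mem_eq_inter,
      Finset.sdiff_eq_filter, Finset.inter_comm]
  have e3 : ∑ w ∈ I, lennardJones (dist q' w) = ∑ y ∈ Fp, lennardJones (dist q' (m y)) :=
    Finset.sum_image hminj
  have e4 : ∑ y ∈ Fp, (lennardJones (dist q' (m y)) - lennardJones (dist p y)) =
      ∑ y ∈ Fp, lennardJones (dist q' (m y)) - ∑ y ∈ Fp, lennardJones (dist p y) :=
    Finset.sum_sub_distrib _ _
  -- sizes of the constants
  have hKG : 27 * R ^ 3 * δ⁻¹ ^ 3 * K = 4 * G * R⁻¹ ^ 3 := by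
    rw [hK, hG]; field_simp; ring
  have hR3 : R⁻¹ ^ 3 ≤ R⁻¹ := by
    have h0 : 0 ≤ R⁻¹ := inv_nonneg.2 hR0.le
    have h1 : R⁻¹ ≤ 1 := inv_le_one_of_one_le₀ hR1
    calc R⁻¹ ^ 3 = R⁻¹ * (R⁻¹ * R⁻¹) := by ring
      _ ≤ R⁻¹ * (1 * 1) := mul_le_mul_of_nonneg_left (mul_le_mul h1 h1 h0 zero_le_one) h0
      _ = R⁻¹ := by ring
  have hGR : 10 * G * R⁻¹ ≤ θ / 2 := by
    rw [div_le_iff₀ hθ] at hRG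
    have e : G * R⁻¹ = G / R := by rw [div_eq_mul_inv]
    rw [mul_assoc, e, ← mul_div_assoc, div_le_iff₀ hR0]
    linarith
  have hLε : 27 * R ^ 3 * δ⁻¹ ^ 3 * (Lip * ε) ≤ θ / 2 := by
    have hpos : 0 < 54 * R ^ 3 * δ⁻¹ ^ 3 * Lip := by positivity
    have h := mul_le_mul_of_nonneg_left hεθ hpos.le
    rw [mul_div_cancel₀ _ hpos.ne'] at h
    nlinarith
  -- conclusion
  have hfin : |(∑ w ∈ Fq, lennardJones (dist q' w)) - ∑ w ∈ Fp, lennardJones (dist p w)| ≤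
      θ / 2 + 8 * G * R⁻¹ ^ 3 := by
    have e5 : (∑ w ∈ Fq, lennardJones (dist q' w)) - ∑ w ∈ Fp, lennardJones (dist p w) =
        ∑ y ∈ Fp, (lennardJones (dist q' (m y)) - lennardJones (dist p y)) +
          ∑ w ∈ Fq \ I, lennardJones (dist q' w) - ∑ w ∈ I \ Fq, lennardJones (dist q' w) := by
      rw [e4, ← e3]; linarith
    rw [e5]
    calc |∑ y ∈ Fp, (lennardJones (dist q' (m y)) - lennardJones (dist p y)) +
            ∑ w ∈ Fq \ I, lennardJones (dist q' w) - ∑ w ∈ I \ Fq, lennardJones (dist q' w)|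
        ≤ |∑ y ∈ Fp, (lennardJones (dist q' (m y)) - lennardJones (dist p y))| +
            |∑ w ∈ Fq \ I, lennardJones (dist q' w)| + |∑ w ∈ I \ Fq, lennardJones (dist q' w)| := by
          refine (abs_sub _ _).trans ?_
          linarith [abs_add_le (∑ y ∈ Fp, (lennardJones (dist q' (m y)) - lennardJones (dist p y)))
            (∑ w ∈ Fq \ I, lennardJones (dist q' w))]
      _ ≤ θ / 2 + 8 * G * R⁻¹ ^ 3 := by linarith [hB1, hB2, hB3, hKG, hLε]
  have htot : θ / 2 + 8 * G * R⁻¹ ^ 3 + G * R⁻¹ ^ 3 + G * R⁻¹ ^ 3 ≤ θ := by nlinarith [hGR, hR3, hG0]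
  have hq := abs_le.1 htq
  have hp' := abs_le.1 htp
  have hf := abs_le.1 hfin
  rw [abs_le]; constructor <;> linarith [hsq, hsp]

end Summit.AtomisticToContinuum.Crystallization.Theorems.OverbindingBudgetPatchContinuity
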